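import Literature.AlgebraicGeometry.Resolution.NormalizationInExtension
import Mathlib.AlgebraicGeometry.Stalk

/-!
# Route `RadicialJung`, crux `CleanModelsSuffice`, line `Sketch`: sections and germs of the
# normalisation `V^L` as elements of `L`

Helper for the registered stub `stub_charts` of the skeleton of
`Summit.ResolutionOfSingularities.ResolutionOfSingularities.Theses.RadicialJung.CleanModelsSuffice`
(stmt-ResolutionOfSingularities-15883). The Kato charts on `V^L = normalizationIn V L` are built
from, and compared through, their values in the field `L`. This file provides the bookkeeping:

* `stalkToField V L x : 𝒪_{V^L,x} →+* L` — specialise to the image of the point of `Spec L`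
  (the generic point of `V^L`), take the stalk map of `Spec L → V^L`, and identify the stalk of
  `Spec L` with `L`;
* `sectionToField V L W hW : Γ(V^L, W) →+* L` for a non-empty open `W` — pull back along
  `Spec L → V^L` (whose image lies in every non-empty open) and take global sections;
* the compatibilities `stalkToField_germ` (germ then `stalkToField` = `sectionToField`),
  `sectionToField_map` (restriction), `sectionToField_app` (a section of `V` goes to its image
  under `Γ(V, U) → K(V) → L`);
* for an affine non-empty `U ⊆ V`, the ring isomorphism
  `sectionsEquiv : Γ(V^L, ι⁻¹U) ≃+* integralClosure Γ(V, U) L` (Mathlib's `normalizationObjIso`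
  followed by `Γ(Spec L, ξ⁻¹U) ≅ L`), with `(sectionsEquiv σ : L) = sectionToField σ` and
  `sectionsEquiv (ι^* r) = r`.
-/

noncomputable section

set_option linter.dupNamespace false -- mandated namespace of this single-conjunct summit

open CategoryTheory AlgebraicGeometry TopologicalSpace Opposite
open Literature.AlgebraicGeometry.Resolution

namespace Summit.ResolutionOfSingularities.ResolutionOfSingularities.Theorems.RadicialJung.CleanModelsSuffice

universe u

variable (V : Scheme.{u}) [IsIntegral V] (L : Type u) [Field L] [Algebra V.functionField L]

/-! ## The point of `Spec L` and its image in `V^L` -/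

/-- Every point of `Spec L` is its closed point. [folklore] -/
theorem eq_closedPoint (q : Spec (.of L)) : q = IsLocalRing.closedPoint L :=
  Subsingleton.elim _ _

/-- The image of the point of `Spec L` in `V^L` specialises to every point (it is the generic
point: `Spec L → V^L` is dominant). [folklore] -/
theorem toNormalization_specializes (x : normalizationIn V L) :
    (fromSpecExtension V L).toNormalization (IsLocalRing.closedPoint L) ⤳ x := by
  rw [specializes_iff_mem_closure]
  have hrange : Set.range (fromSpecExtension V L).toNormalization =
      {(fromSpecExtension V L).toNormalization (IsLocalRing.closedPoint L)} := by
    ext z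
    simp only [Set.mem_range, Set.mem_singleton_iff]
    constructor
    · rintro ⟨q, rfl⟩; rw [eq_closedPoint L q]
    · rintro rfl; exact ⟨_, rfl⟩
  have h := (fromSpecExtension V L).toNormalization.denseRange.closure_range
  change closure (Set.range (fromSpecExtension V L).toNormalization) = Set.univ at h
  rw [hrange] at h
  rw [h]
  trivial

/-- Every non-empty open of `V^L` pulls back to all of `Spec L`. [folklore] -/
theorem top_le_preimage_toNormalization {W : (normalizationIn V L).Opens}
    (hW : (W : Set (normalizationIn V L)).Nonempty) :
    ⊤ ≤ (fromSpecExtension V L).toNormalization ⁻¹ᵁ W := by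
  intro q _
  obtain ⟨x, hx⟩ := hW
  change (fromSpecExtension V L).toNormalization q ∈ W
  rw [eq_closedPoint L q]
  exact (toNormalization_specializes V L x).mem_open W.isOpen hx

/-- The image of the point of `Spec L` lies in `ι⁻¹U` for every non-empty open `U ⊆ V`.
[folklore] -/
theorem toNormalization_mem_preimage {U : V.Opens} (hU : (U : Set V).Nonempty) :
    (fromSpecExtension V L).toNormalization (IsLocalRing.closedPoint L) ∈
      normalizationInι V L ⁻¹ᵁ U := by
  change ((fromSpecExtension V L).toNormalization ≫ normalizationInι V L)
    (IsLocalRing.closedPoint L) ∈ U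
  rw [normalizationInι, Scheme.Hom.toNormalization_fromNormalization, fromSpecExtension_apply]
  exact ((genericPoint_spec V).mem_open_set_iff U.isOpen).mpr (by simpa using hU)

/-! ## Germs and sections as elements of `L` -/

/-- **`𝒪_{V^L,x} → L`**: specialise to the image of the point of `Spec L`, apply the stalk map of
`Spec L → V^L`, and identify the stalk of `Spec L` at its point with `L`. [folklore] -/
def stalkToField (x : normalizationIn V L) : (normalizationIn V L).presheaf.stalk x →+* L :=
  ((normalizationIn V L).presheaf.stalkSpecializes (toNormalization_specializes V L x) ≫
    (fromSpecExtension V L).toNormalization.stalkMap (IsLocalRing.closedPoint L) ≫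
    (stalkClosedPointIso (.of L)).hom).hom

/-- **`Γ(V^L, W) → L`** for a non-empty open `W`: pull back along `Spec L → V^L` to global
sections of `Spec L`, i.e. `L`. [folklore] -/
def sectionToField (W : (normalizationIn V L).Opens) (hW : (W : Set (normalizationIn V L)).Nonempty) :
    Γ(normalizationIn V L, W) →+* L :=
  ((fromSpecExtension V L).toNormalization.appLE W ⊤ (top_le_preimage_toNormalization V L hW) ≫
    (Scheme.ΓSpecIso (.of L)).hom).hom

/-- **Germ, then `stalkToField`, is `sectionToField`.** [folklore] -/
theorem stalkToField_germ (W : (normalizationIn V L).Opens) (x : normalizationIn V L) (hx : x ∈ W)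
    (s : Γ(normalizationIn V L, W)) :
    stalkToField V L x ((normalizationIn V L).presheaf.germ W x hx s) =
      sectionToField V L W ⟨x, hx⟩ s := by
  have key : (fromSpecExtension V L).normalization.presheaf.germ W x hx ≫
      (fromSpecExtension V L).normalization.presheaf.stalkSpecializes
        (toNormalization_specializes V L x) ≫
      (fromSpecExtension V L).toNormalization.stalkMap (IsLocalRing.closedPoint L) ≫
      (stalkClosedPointIso (.of L)).hom =
      (fromSpecExtension V L).toNormalization.appLE W ⊤ (top_le_preimage_toNormalization V L ⟨x, hx⟩) ≫
        (Scheme.ΓSpecIso (.of L)).hom := by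
    rw [TopCat.Presheaf.germ_stalkSpecializes_assoc, Scheme.Hom.germ_stalkMap_assoc,
      ← germ_stalkClosedPointIso_hom (.of L), Scheme.Hom.appLE, Category.assoc]
    congr 1
    rw [TopCat.Presheaf.germ_res_assoc]
  change ((fromSpecExtension V L).normalization.presheaf.germ W x hx ≫
      (fromSpecExtension V L).normalization.presheaf.stalkSpecializes
        (toNormalization_specializes V L x) ≫
      (fromSpecExtension V L).toNormalization.stalkMap (IsLocalRing.closedPoint L) ≫
      (stalkClosedPointIso (.of L)).hom).hom s =
    ((fromSpecExtension V L).toNormalization.appLE W ⊤ (top_le_preimage_toNormalization V L ⟨x, hx⟩) ≫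
        (Scheme.ΓSpecIso (.of L)).hom).hom s
  rw [key]

/-- `sectionToField` is compatible with restriction. [folklore] -/
theorem sectionToField_map {W W' : (normalizationIn V L).Opens} (i : W' ≤ W)
    (hW' : (W' : Set (normalizationIn V L)).Nonempty) (s : Γ(normalizationIn V L, W)) :
    sectionToField V L W' hW' ((normalizationIn V L).presheaf.map (homOfLE i).op s) =
      sectionToField V L W (hW'.mono i) s := by
  have key := Scheme.Hom.map_appLE (fromSpecExtension V L).toNormalization
    (top_le_preimage_toNormalization V L hW') (homOfLE i).op
  exact congrArg (fun φ => (Scheme.ΓSpecIso (.of L)).hom.hom (φ.hom s)) key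

/-- Restricting from `⊤` to `ξ⁻¹U` and back is the identity on `Γ(Spec L, ⊤)`. [folklore] -/
theorem map_map_eq_self {U : V.Opens} (h : ⊤ ≤ fromSpecExtension V L ⁻¹ᵁ U)
    (ℓ : Γ(Spec (.of L), ⊤)) :
    (Spec (.of L)).presheaf.map (homOfLE h).op
      ((Spec (.of L)).presheaf.map (homOfLE (le_top : fromSpecExtension V L ⁻¹ᵁ U ≤ ⊤)).op ℓ) = ℓ := by
  rw [← CommRingCat.comp_apply, ← Functor.map_comp, ← op_comp,
    show homOfLE h ≫ homOfLE le_top = 𝟙 _ from Subsingleton.elim _ _, op_id,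
    CategoryTheory.Functor.map_id]
  rfl

/-- **A section of `V` goes to its value in `L`**: for `r ∈ Γ(V, U)`,
`sectionToField (ι^* r) = (Γ(V, U) → K(V) → L)(r)`. [folklore] -/
theorem sectionToField_app {U : V.Opens} (hU : (U : Set V).Nonempty) (r : Γ(V, U)) :
    sectionToField V L (normalizationInι V L ⁻¹ᵁ U) ⟨_, toNormalization_mem_preimage V L hU⟩
      ((normalizationInι V L).app U r) =
      algebraMap V.functionField L (V.presheaf.germ U (genericPoint V)
        (((genericPoint_spec V).mem_open_set_iff U.isOpen).mpr (by simpa using hU)) r) := by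
  have hW := toNormalization_mem_preimage V L hU
  have le₁ : ⊤ ≤ (fromSpecExtension V L).toNormalization ⁻¹ᵁ (normalizationInι V L ⁻¹ᵁ U) :=
    top_le_preimage_toNormalization V L ⟨_, hW⟩
  have h3 : (fromSpecExtension V L).toNormalization ≫ normalizationInι V L = fromSpecExtension V L :=
    Scheme.Hom.toNormalization_fromNormalization _
  -- the statement for `ξ = toNorm ≫ ι` itself
  have h2 : ∀ (g : Spec (.of L) ⟶ V) (_ : g = fromSpecExtension V L) (e : ⊤ ≤ g ⁻¹ᵁ U)
      (r : Γ(V, U)), (Scheme.ΓSpecIso (.of L)).hom (g.appLE U ⊤ e r) =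
      algebraMap V.functionField L (V.presheaf.germ U (genericPoint V)
        (((genericPoint_spec V).mem_open_set_iff U.isOpen).mpr (by simpa using hU)) r) := by
    rintro g rfl e r
    change (Scheme.ΓSpecIso (.of L)).hom ((Spec (.of L)).presheaf.map (homOfLE e).op
      ((fromSpecExtension V L).app U r)) = _
    rw [fromSpecExtension_app_apply hU r]
    change (Scheme.ΓSpecIso (.of L)).hom ((Spec (.of L)).presheaf.map (homOfLE e).op
      ((Spec (.of L)).presheaf.map (homOfLE (le_top : fromSpecExtension V L ⁻¹ᵁ U ≤ ⊤)).op
        ((Scheme.ΓSpecIso (.of L)).inv (algebraMap V.functionField L (V.presheaf.germ U (genericPoint V)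
        (((genericPoint_spec V).mem_open_set_iff U.isOpen).mpr (by simpa using hU)) r))))) = _
    rw [map_map_eq_self V L, ← CommRingCat.comp_apply, Iso.inv_hom_id, CommRingCat.id_apply]
  -- `ι^* ≫ toNorm^* = (toNorm ≫ ι)^*`
  have h1 : (normalizationInι V L).app U ≫
      (fromSpecExtension V L).toNormalization.appLE (normalizationInι V L ⁻¹ᵁ U) ⊤ le₁ =
      ((fromSpecExtension V L).toNormalization ≫ normalizationInι V L).appLE U ⊤ le₁ :=
    (Scheme.Hom.comp_appLE _ _ _ _ _).symm
  change (Scheme.ΓSpecIso (.of L)).hom (((normalizationInι V L).app U ≫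
    (fromSpecExtension V L).toNormalization.appLE (normalizationInι V L ⁻¹ᵁ U) ⊤ le₁) r) = _
  rw [h1]
  exact h2 _ h3 le₁ r

/-! ## Sections over an affine open as the integral closure of `Γ(V, U)` in `L` -/

section Affine

variable {V L}
variable {U : V.Opens} (hU : IsAffineOpen U) [hne : Nonempty U]

/-- `L` as a `Γ(V, U)`-algebra through `Γ(V, U) → K(V) → L` (for a non-empty open `U`).
[folklore] -/
abbrev sectionsAlgebra (U : V.Opens) [Nonempty U] : Algebra Γ(V, U) L :=
  ((algebraMap V.functionField L).comp (V.germToFunctionField U).hom).toAlgebra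

attribute [local instance] sectionsAlgebra

/-- `Γ(V, U) → K(V) → L` is a scalar tower (by definition of `sectionsAlgebra`). [folklore] -/
theorem isScalarTower_sectionsAlgebra (U : V.Opens) [Nonempty U] :
    IsScalarTower Γ(V, U) V.functionField L :=
  IsScalarTower.of_algebraMap_eq fun _ => rfl

omit [IsIntegral V] in
/-- The coercion of a non-empty open is non-empty. [folklore] -/
theorem coe_nonempty (U : V.Opens) [h : Nonempty U] : (U : Set V).Nonempty := by
  obtain ⟨x⟩ := h; exact ⟨x.1, x.2⟩

/-- `L ≃ Γ(Spec L, ξ⁻¹U)` as `Γ(V, U)`-algebras (`Γ(V, U)` acting on the right through `ξ^*`).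
[folklore] -/
def extensionAlgEquiv (U : V.Opens) [Nonempty U] :
    letI := ((fromSpecExtension V L).app U).hom.toAlgebra
    L ≃ₐ[Γ(V, U)] Γ(Spec (.of L), fromSpecExtension V L ⁻¹ᵁ U) :=
  letI := ((fromSpecExtension V L).app U).hom.toAlgebra
  { (extensionIsoSections (X := V) (L := L) (coe_nonempty U)).commRingCatIsoToRingEquiv with
    commutes' := fun a => (fromSpecExtension_app_apply (X := V) (L := L) (coe_nonempty U) a).symm }

/-- **`Γ(V^L, ι⁻¹U) ≃ integralClosure Γ(V, U) L`** for an affine non-empty open `U ⊆ V`: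
Mathlib's `normalizationObjIso` followed by the identification `Γ(Spec L, ξ⁻¹U) ≅ L`.
[cite: Liu2002, Def. 4.1.24, p. 155] -/
def sectionsEquiv : Γ(normalizationIn V L, normalizationInι V L ⁻¹ᵁ U) ≃+*
    integralClosure Γ(V, U) L :=
  letI := ((fromSpecExtension V L).app U).hom.toAlgebra
  let e := extensionAlgEquiv (V := V) (L := L) U
  let eC : integralClosure Γ(V, U) L ≃ₐ[Γ(V, U)]
      integralClosure Γ(V, U) Γ(Spec (.of L), fromSpecExtension V L ⁻¹ᵁ U) :=
    ((integralClosure Γ(V, U) L).equivMapOfInjective e.toAlgHom e.injective).trans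
      (Subalgebra.equivOfEq _ _ (integralClosure_map_algEquiv e))
  ((fromSpecExtension V L).normalizationObjIso hU).commRingCatIsoToRingEquiv.trans
    eC.symm.toRingEquiv

/-- The value in `L` of `sectionsEquiv σ` is the image of `(normalizationObjIso σ).val` under
`Γ(Spec L, ξ⁻¹U) ≅ L`. [folklore] -/
theorem coe_sectionsEquiv_eq (σ : Γ(normalizationIn V L, normalizationInι V L ⁻¹ᵁ U)) :
    letI := ((fromSpecExtension V L).app U).hom.toAlgebra
    ((sectionsEquiv hU σ : integralClosure Γ(V, U) L) : L) =
      (extensionIsoSections (X := V) (L := L) (coe_nonempty U)).inv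
        (((fromSpecExtension V L).normalizationObjIso hU).hom σ).val := by
  letI := ((fromSpecExtension V L).app U).hom.toAlgebra
  let e := extensionAlgEquiv (V := V) (L := L) U
  let eC : integralClosure Γ(V, U) L ≃ₐ[Γ(V, U)]
      integralClosure Γ(V, U) Γ(Spec (.of L), fromSpecExtension V L ⁻¹ᵁ U) :=
    ((integralClosure Γ(V, U) L).equivMapOfInjective e.toAlgHom e.injective).trans
      (Subalgebra.equivOfEq _ _ (integralClosure_map_algEquiv e))
  set c := ((fromSpecExtension V L).normalizationObjIso hU).hom σ with hc
  have h1 : (sectionsEquiv hU σ : integralClosure Γ(V, U) L) = eC.symm c := rfl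
  have h2 : ((eC (eC.symm c) : integralClosure Γ(V, U) _) : Γ(Spec (.of L), _)) =
      e ((eC.symm c : integralClosure Γ(V, U) L) : L) := rfl
  rw [AlgEquiv.apply_symm_apply] at h2
  rw [h1]
  apply e.injective
  change e _ = (extensionIsoSections (X := V) (L := L) (coe_nonempty U)).hom
    ((extensionIsoSections (X := V) (L := L) (coe_nonempty U)).inv c.val)
  rw [← CommRingCat.comp_apply, Iso.inv_hom_id, CommRingCat.id_apply]
  exact h2.symm

/-- **`(sectionsEquiv σ : L) = sectionToField σ`.** [folklore] -/
theorem coe_sectionsEquiv (σ : Γ(normalizationIn V L, normalizationInι V L ⁻¹ᵁ U)) :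
    ((sectionsEquiv hU σ : integralClosure Γ(V, U) L) : L) =
      sectionToField V L (normalizationInι V L ⁻¹ᵁ U)
        ⟨_, toNormalization_mem_preimage V L (coe_nonempty U)⟩ σ := by
  letI := ((fromSpecExtension V L).app U).hom.toAlgebra
  have pf : fromSpecExtension V L ⁻¹ᵁ U ≤
      (fromSpecExtension V L).toNormalization ⁻¹ᵁ (normalizationInι V L ⁻¹ᵁ U) := by
    rw [← Scheme.Hom.comp_preimage, normalizationInι, Scheme.Hom.toNormalization_fromNormalization]
  have hval : (((fromSpecExtension V L).normalizationObjIso hU).hom σ).val =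
      (fromSpecExtension V L).toNormalization.appLE (normalizationInι V L ⁻¹ᵁ U)
        (fromSpecExtension V L ⁻¹ᵁ U) pf σ :=
    congrArg (fun φ => φ.hom σ) ((fromSpecExtension V L).normalizationObjIso_hom_val hU)
  have hle : ⊤ ≤ fromSpecExtension V L ⁻¹ᵁ U := by
    rw [preimage_fromSpecExtension V L (coe_nonempty U)]
  haveI := isIso_map_homOfLE_preimage_fromSpecExtension (X := V) (L := L) (coe_nonempty U)
  have hinv : inv ((Spec (.of L)).presheaf.map
      (homOfLE (le_top : fromSpecExtension V L ⁻¹ᵁ U ≤ ⊤)).op) =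
      (Spec (.of L)).presheaf.map (homOfLE hle).op := by
    apply IsIso.inv_eq_of_hom_inv_id
    ext ℓ
    exact map_map_eq_self V L hle ℓ
  have key := Scheme.Hom.appLE_map (fromSpecExtension V L).toNormalization pf (homOfLE hle).op
  rw [coe_sectionsEquiv_eq, hval]
  change (Scheme.ΓSpecIso (.of L)).hom (inv ((Spec (.of L)).presheaf.map
      (homOfLE (le_top : fromSpecExtension V L ⁻¹ᵁ U ≤ ⊤)).op)
      ((fromSpecExtension V L).toNormalization.appLE (normalizationInι V L ⁻¹ᵁ U)
        (fromSpecExtension V L ⁻¹ᵁ U) pf σ)) =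
    (Scheme.ΓSpecIso (.of L)).hom ((fromSpecExtension V L).toNormalization.appLE
      (normalizationInι V L ⁻¹ᵁ U) ⊤
      (top_le_preimage_toNormalization V L ⟨_, toNormalization_mem_preimage V L (coe_nonempty U)⟩) σ)
  rw [hinv]
  exact congrArg (fun φ => (Scheme.ΓSpecIso (.of L)).hom.hom (φ.hom σ)) key

/-- **`sectionsEquiv (ι^* r) = r`**: the isomorphism is compatible with `Γ(V, U)`. [folklore] -/
theorem sectionsEquiv_app (r : Γ(V, U)) :
    sectionsEquiv hU ((normalizationInι V L).app U r) =
      algebraMap Γ(V, U) (integralClosure Γ(V, U) L) r := by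
  apply Subtype.ext
  rw [coe_sectionsEquiv, sectionToField_app V L (coe_nonempty U) r]
  rfl

include hU in
/-- `sectionToField` on `ι⁻¹U` takes values in the integral closure of `Γ(V, U)`. [folklore] -/
theorem isIntegral_sectionToField (σ : Γ(normalizationIn V L, normalizationInι V L ⁻¹ᵁ U)) :
    IsIntegral Γ(V, U) (sectionToField V L (normalizationInι V L ⁻¹ᵁ U)
      ⟨_, toNormalization_mem_preimage V L (coe_nonempty U)⟩ σ) := by
  rw [← coe_sectionsEquiv hU]
  exact (sectionsEquiv hU σ).2

/-- **Lifting integral elements of `L` to sections of `V^L`**: a monoid homomorphism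
`Φ : M → (L, ·)` with values integral over `Γ(V, U)` (`U` affine, non-empty) lifts to
`M → Γ(V^L, ι⁻¹U)` with `sectionToField ∘ lift = Φ`. [folklore] -/
def liftToSections {M : Type*} [Monoid M] (Φ : M →* L) (hΦ : ∀ c, IsIntegral Γ(V, U) (Φ c)) :
    M →* Γ(normalizationIn V L, normalizationInι V L ⁻¹ᵁ U) :=
  (sectionsEquiv hU).symm.toMonoidHom.comp (Φ.codRestrict (integralClosure Γ(V, U) L) hΦ)

/-- The lift recovers `Φ` in `L`. [folklore] -/
theorem sectionToField_liftToSections {M : Type*} [Monoid M] (Φ : M →* L)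
    (hΦ : ∀ c, IsIntegral Γ(V, U) (Φ c)) (c : M) :
    sectionToField V L (normalizationInι V L ⁻¹ᵁ U)
      ⟨_, toNormalization_mem_preimage V L (coe_nonempty U)⟩ (liftToSections hU Φ hΦ c) = Φ c := by
  rw [← coe_sectionsEquiv hU]
  simp [liftToSections]

end Affine

/-- **Germ, then `stalkToField`, is `sectionToField`** (universe-`0` form, the registered
interface of this helper file). [folklore] -/
theorem stalkToField_germ_eq (V₀ : Scheme.{0}) [IsIntegral V₀] (L₀ : Type) [Field L₀]
    [Algebra V₀.functionField L₀] (W : (normalizationIn V₀ L₀).Opens) (x : normalizationIn V₀ L₀)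
    (hx : x ∈ W) (s : Γ(normalizationIn V₀ L₀, W)) :
    stalkToField V₀ L₀ x ((normalizationIn V₀ L₀).presheaf.germ W x hx s) =
      sectionToField V₀ L₀ W ⟨x, hx⟩ s :=
  stalkToField_germ V₀ L₀ W x hx s

end Summit.ResolutionOfSingularities.ResolutionOfSingularities.Theorems.RadicialJung.CleanModelsSuffice

end
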